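import Summits.Ventures.HSemireg.WedgeHankelRecurrenceGaussJacobiDifferentialEquation

/-!
# Venture HSemireg — **THE JACOBI VALUES AT `±1`, THE SUM OF THE ZEROS, AND HILBERT'S JACOBI DISCRIMINANT IN PRODUCT FORM** (monic `P̃^{(α,β)}`, `α, β > −1`, data of N402):
# **`q_{n+1}(1) = (2(α+1)∕(σ+2)) ∏_{k<n} 2(k+2+α)(k+2+σ)∕((2k+3+σ)(2k+4+σ))`** (the product of the Karlin–McGregor birth rates `2λ_k` of N402), **`q_{n+1}(−1) = (−1)^{n+1} · (same with α ↔ β)`**,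
# **`Σ_k x_k = (t+1)(β−α)∕(2t+2+σ)`**, and by SCHUR's method (N404) with the structure relation of N411:
# **`q_{n+1}(1) · (−1)^{n+1} q_{n+1}(−1) · disc(q_{n+1}) = ((2n+σ+3) b_{n+1})^{n+1} ∏_{k<n} b_{k+1}^{k+1}`** (Szegő (6.71.5) in exact product form)

HONEST FRAMING. Part of the Lean index of the computation cell `pub-hsemireg` (seat p10 gen 47, Sunday typer «UNIFORM-IN-n»).  Rational identities and polynomial algebra over `ℝ` (Mathlib
`Polynomial.resultant ∕ discr`) only; no variety, no cohomology theory, no sheaf, no Ext group and no semiregularity map is constructed here; nothing here says that HC / HC_CM / HC_AV holds; no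
Literature fact (unproved `Prop`) is declared or used.  Custodian versions as in `WedgeHankelSiegelIdeal` (1/3).
SOURCES (cited).  G. Szegő, *Orthogonal Polynomials*, (4.1.1) (`P_n^{(α,β)}(1) = binom(n+α, n)`), (4.1.4) (`P_n^{(α,β)}(−x) = (−1)^n P_n^{(β,α)}(x)`), (4.21.6) (leading coefficient), Thm 6.71
eq. (6.71.5) (Hilbert's discriminant of `P_n^{(α,β)}`); D. Hilbert, J. reine angew. Math. 103 (1888) 337–345; T. J. Stieltjes, C. R. Acad. Sci. Paris 100 (1885) 620–622; S. Karlin, J. McGregor,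
Trans. AMS 85 (1957) 489–546 (the rates).  Monic normalisation: `q_n(1) = 2^n (α+1)_n ∕ (n+σ+1)_n`, written here as the telescoped product of the ratios `q_{k+1}(1)∕q_k(1) = 2λ_k`.
PROOF TYPED HERE.  `q_n(1)` by a two-step induction on the recurrence at `x = 1` (`2λ_{n+1}·2λ_n = (1 − a_{n+1}) 2λ_n − b_{n+1}`, one `field_simp; ring` per case); `q_n(−1)` from the reflected
recurrence (N325 `recurrence_reflect_spec`, which is the Jacobi recurrence with `α ↔ β`, as in N402); `Σ x_k` from N298 `sum_recurrence_zeros` and the telescoping `d_{m+2} = d_{m+1} + a_{m+1}`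
(N411); the discriminant from N404 `resultant_mul_discr_recurrence` (`π = X² − 1`, `A = (n+1)X + d_{n+1}`, `c = −e_{n+1}`) and N409 `resultant_X_sq_sub_one`.
DEDUP DISCLOSURE (`rg -n -i 'jacobi_eval|jacobi_discr|jacobi_zeros_sum' Summits/Ventures/HSemireg/WedgeHankelRecurrenceGauss*`, 2026-09-04): N409 (`α = β` values and discriminant); the general
`(α, β)` statements are new; 0 hits for the 6 names below.

WHAT IS IN THE TREE.  N402 (recurrence data, zeros in `(−1,1)`), N411 `jacobi_structure_relation ∕ jacobi_scalar_identities`, N404 `resultant_mul_discr_recurrence`, N409 `resultant_X_sq_sub_one`,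
N325 `recurrence_reflect_spec`, N298 `sum_recurrence_zeros`.
THIS FILE (namespace `Summit.Ventures.HSemireg.Wedge.HankelOuter` continued; CHAINED on N412 (import only); 0 definitions):
* §1178 **`jacobi_eval_one`**, **`jacobi_eval_neg_one`**, **`jacobi_zeros_sum`** (`Σ x_k = (t+1)(β−α)∕(2t+2+σ)`), `jacobi_resultant_X_sq_sub_one` (`Res(q_{n+1}, X²−1) = q_{n+1}(1) q_{n+1}(−1)`),
  **`jacobi_discr_mul`** (`q(1)·(−1)^{n+1}q(−1)·disc = e_{n+1}^{n+1} ∏ b_{k+1}^{k+1}`), **`jacobi_discr`** (divided form with both products inserted).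
CAVEATS.  `α, β > −1`; exact product forms (no Gamma-function closed form is asserted).  Nothing Ext-side.  New names only.
-/

open Module Polynomial
open scoped Matrix Polynomial

namespace Summit.Ventures.HSemireg.Wedge.HankelOuter

/-! ## §1178. Jacobi values at `±1`, trace, Hilbert's discriminant -/

/-- **THE MONIC JACOBI VALUE AT `1`: `q_{n+1}(1) = (2(α+1)∕(α+β+2)) · ∏_{k<n} 2(k+2+α)(k+2+α+β) ∕ ((2k+3+α+β)(2k+4+α+β))`** (`= 2^{n+1}(α+1)_{n+1}∕(n+α+β+2)_{n+1}`). [Szegő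
(4.1.1), (4.21.6); Karlin–McGregor 1957; this file, §1178] -/
theorem jacobi_eval_one {q : ℕ → ℝ[X]} {a b : ℕ → ℝ} {α β : ℝ} (hq0 : q 0 = 1) (hq1 : q 1 = Polynomial.X - C (a 0))
    (hrec : ∀ n, q (n + 2) = (Polynomial.X - C (a (n + 1))) * q (n + 1) - C (b (n + 1)) * q n) (hα : -1 < α) (hβ : -1 < β) (ha0 : a 0 = (β - α) / (α + β + 2))
    (ha : ∀ n : ℕ, a (n + 1) = (β ^ 2 - α ^ 2) / ((2 * n + 2 + (α + β)) * (2 * n + 4 + (α + β))))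
    (hb1 : b 1 = 4 * (1 + α) * (1 + β) / ((α + β + 2) ^ 2 * (α + β + 3)))
    (hb : ∀ n : ℕ, b (n + 2) = 4 * ((n : ℝ) + 2) * ((n : ℝ) + 2 + α) * ((n : ℝ) + 2 + β) * ((n : ℝ) + 2 + (α + β)) /
      ((2 * n + 3 + (α + β)) * (2 * n + 4 + (α + β)) ^ 2 * (2 * n + 5 + (α + β)))) (n : ℕ) :
    (q (n + 1)).eval 1 = 2 * (α + 1) / (α + β + 2) * ∏ k ∈ Finset.range n, 2 * ((k : ℝ) + 2 + α) * ((k : ℝ) + 2 + (α + β)) / ((2 * (k : ℝ) + 3 + (α + β)) * (2 * (k : ℝ) + 4 + (α + β))) := by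
  have h2 : α + β + 2 ≠ 0 := by linarith
  have h3 : α + β + 3 ≠ 0 := by linarith
  have hn : ∀ (m : ℕ) (k : ℝ), 2 ≤ k → 2 * (m : ℝ) + k + (α + β) ≠ 0 := fun m k hk => by
    have h0 : (0 : ℝ) ≤ m := Nat.cast_nonneg m
    linarith
  have key : ∀ n, (q (n + 1)).eval 1 = 2 * (α + 1) / (α + β + 2) * ∏ k ∈ Finset.range n, 2 * ((k : ℝ) + 2 + α) * ((k : ℝ) + 2 + (α + β)) / ((2 * (k : ℝ) + 3 + (α + β)) * (2 * (k : ℝ) + 4 + (α + β))) ∧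
      (q (n + 2)).eval 1 = 2 * (α + 1) / (α + β + 2) * ∏ k ∈ Finset.range (n + 1), 2 * ((k : ℝ) + 2 + α) * ((k : ℝ) + 2 + (α + β)) / ((2 * (k : ℝ) + 3 + (α + β)) * (2 * (k : ℝ) + 4 + (α + β))) := by
    intro n
    induction n with
    | zero =>
      have e1 : (q 1).eval 1 = 2 * (α + 1) / (α + β + 2) := by
        rw [hq1, ha0, eval_sub, eval_X, eval_C]; field_simp; ring
      refine ⟨by rw [zero_add, e1, Finset.prod_range_zero, mul_one], ?_⟩
      rw [zero_add, hrec 0, zero_add, eval_sub, eval_mul, eval_sub, eval_X, eval_C, eval_mul, eval_C, e1, hq0, eval_one, ha 0, hb1, Finset.prod_range_one]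
      push_cast
      have h4 : α + β + 4 ≠ 0 := by linarith
      rw [show (2 * 0 + 2 + (α + β)) = α + β + 2 by ring, show (2 * 0 + 4 + (α + β)) = α + β + 4 by ring, show (2 * 0 + 3 + (α + β)) = α + β + 3 by ring,
        show ((0 : ℝ) + 2 + (α + β)) = α + β + 2 by ring]
      field_simp
      ring
    | succ n ih =>
      obtain ⟨ih1, ih2⟩ := ih
      refine ⟨by rw [show n + 1 + 1 = n + 2 from rfl]; exact ih2, ?_⟩
      -- the rate identity `(1 − a_{n+2}) R_n − b_{n+2} = R_n R_{n+1}`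
      have h3' := hn n 3 (by norm_num); have h4 := hn n 4 (by norm_num); have h5 := hn n 5 (by norm_num); have h6 := hn n 6 (by norm_num)
      have hA2 : a (n + 2) = (β ^ 2 - α ^ 2) / ((2 * (n : ℝ) + 4 + (α + β)) * (2 * (n : ℝ) + 6 + (α + β))) := by
        rw [show n + 2 = n + 1 + 1 from rfl, ha (n + 1)]; push_cast
        rw [div_eq_div_iff (mul_ne_zero (by intro h; apply h4; linarith) (by intro h; apply h6; linarith)) (mul_ne_zero h4 h6)]; ring
      have hstep : (1 - a (n + 2)) * (2 * ((n : ℝ) + 2 + α) * ((n : ℝ) + 2 + (α + β)) / ((2 * (n : ℝ) + 3 + (α + β)) * (2 * (n : ℝ) + 4 + (α + β)))) - b (n + 2) =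
          2 * ((n : ℝ) + 2 + α) * ((n : ℝ) + 2 + (α + β)) / ((2 * (n : ℝ) + 3 + (α + β)) * (2 * (n : ℝ) + 4 + (α + β))) *
            (2 * (((n + 1 : ℕ) : ℝ) + 2 + α) * (((n + 1 : ℕ) : ℝ) + 2 + (α + β)) / ((2 * ((n + 1 : ℕ) : ℝ) + 3 + (α + β)) * (2 * ((n + 1 : ℕ) : ℝ) + 4 + (α + β)))) := by
        rw [hA2, hb n]; push_cast
        rw [one_sub_div (mul_ne_zero h4 h6), div_mul_div_comm, div_sub_div _ _ (mul_ne_zero (mul_ne_zero h4 h6) (mul_ne_zero h3' h4)) (mul_ne_zero (mul_ne_zero h3' (pow_ne_zero 2 h4)) h5),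
          div_mul_div_comm, div_eq_div_iff (mul_ne_zero (mul_ne_zero (mul_ne_zero h4 h6) (mul_ne_zero h3' h4)) (mul_ne_zero (mul_ne_zero h3' (pow_ne_zero 2 h4)) h5))
          (mul_ne_zero (mul_ne_zero h3' h4) (mul_ne_zero (by intro h; apply h5; linarith) (by intro h; apply h6; linarith)))]
        ring
      rw [show n + 1 + 2 = (n + 1) + 2 from rfl, hrec (n + 1), show n + 1 + 1 = n + 2 from rfl, eval_sub, eval_mul, eval_sub, eval_X, eval_C, eval_mul, eval_C, ih1, ih2,
        Finset.prod_range_succ _ (n + 1), Finset.prod_range_succ _ n]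
      linear_combination (2 * (α + 1) / (α + β + 2) * ∏ k ∈ Finset.range n, 2 * ((k : ℝ) + 2 + α) * ((k : ℝ) + 2 + (α + β)) / ((2 * (k : ℝ) + 3 + (α + β)) * (2 * (k : ℝ) + 4 + (α + β)))) * hstep
  exact (key n).1

/-- **THE MONIC JACOBI VALUE AT `−1`: `q_{n+1}(−1) = (−1)^{n+1} (2(β+1)∕(α+β+2)) ∏_{k<n} 2(k+2+β)(k+2+α+β)∕((2k+3+α+β)(2k+4+α+β))`** (the reflected recurrence is the `(β, α)` recurrence).
[Szegő (4.1.4); this file, §1178] -/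
theorem jacobi_eval_neg_one {q : ℕ → ℝ[X]} {a b : ℕ → ℝ} {α β : ℝ} (hq0 : q 0 = 1) (hq1 : q 1 = Polynomial.X - C (a 0))
    (hrec : ∀ n, q (n + 2) = (Polynomial.X - C (a (n + 1))) * q (n + 1) - C (b (n + 1)) * q n) (hα : -1 < α) (hβ : -1 < β) (ha0 : a 0 = (β - α) / (α + β + 2))
    (ha : ∀ n : ℕ, a (n + 1) = (β ^ 2 - α ^ 2) / ((2 * n + 2 + (α + β)) * (2 * n + 4 + (α + β))))
    (hb1 : b 1 = 4 * (1 + α) * (1 + β) / ((α + β + 2) ^ 2 * (α + β + 3)))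
    (hb : ∀ n : ℕ, b (n + 2) = 4 * ((n : ℝ) + 2) * ((n : ℝ) + 2 + α) * ((n : ℝ) + 2 + β) * ((n : ℝ) + 2 + (α + β)) /
      ((2 * n + 3 + (α + β)) * (2 * n + 4 + (α + β)) ^ 2 * (2 * n + 5 + (α + β)))) (n : ℕ) :
    (q (n + 1)).eval (-1) =
      (-1) ^ (n + 1) * (2 * (β + 1) / (α + β + 2) * ∏ k ∈ Finset.range n, 2 * ((k : ℝ) + 2 + β) * ((k : ℝ) + 2 + (α + β)) / ((2 * (k : ℝ) + 3 + (α + β)) * (2 * (k : ℝ) + 4 + (α + β)))) := by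
  obtain ⟨h0', h1', hrec', -⟩ := recurrence_reflect_spec hq0 hq1 hrec
  have key := jacobi_eval_one (q := fun n => C ((-1 : ℝ) ^ n) * (q n).comp (C (-1 : ℝ)⁻¹ * Polynomial.X)) (a := fun n => -a n) (b := b) (α := β) (β := α) h0' h1' hrec' hβ hα
    (by rw [ha0]; have : α + β + 2 ≠ 0 := by linarith
        rw [show β + α + 2 = α + β + 2 by ring]; field_simp; ring)
    (fun n => by
      rw [ha n, show β + α = α + β by ring]
      have h0 : (0 : ℝ) ≤ n := Nat.cast_nonneg n
      have h1 : (2 * (n : ℝ) + 2 + (α + β)) * (2 * n + 4 + (α + β)) ≠ 0 := mul_ne_zero (by linarith) (by linarith)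
      field_simp; ring)
    (by rw [hb1, show β + α = α + β by ring]; ring) (fun n => by rw [hb n, show β + α = α + β by ring]; ring) n
  have hev : (C ((-1 : ℝ) ^ (n + 1)) * (q (n + 1)).comp (C (-1 : ℝ)⁻¹ * Polynomial.X)).eval 1 = (-1) ^ (n + 1) * (q (n + 1)).eval (-1) := by
    rw [eval_mul, eval_C, eval_comp, eval_mul, eval_C, eval_X, show (-1 : ℝ)⁻¹ * 1 = -1 by norm_num]
  rw [hev, show β + α = α + β by ring] at key
  have hsq : ((-1 : ℝ) ^ (n + 1)) * ((-1 : ℝ) ^ (n + 1)) = 1 := by rw [← pow_add, ← two_mul, pow_mul, neg_one_sq, one_pow]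
  linear_combination ((-1 : ℝ) ^ (n + 1)) * key - ((q (n + 1)).eval (-1)) * hsq

/-- **THE SUM OF THE JACOBI ZEROS: `Σ_k x_k = (t+1)(β−α) ∕ (2t+2+α+β)`** (trace of the Jacobi matrix, telescoped by `d_{m+2} − d_{m+1} = a_{m+1}`). [Szegő (4.5.1); this file, §1178] -/
theorem jacobi_zeros_sum {q : ℕ → ℝ[X]} {a b : ℕ → ℝ} {α β : ℝ} (hq0 : q 0 = 1) (hq1 : q 1 = Polynomial.X - C (a 0))
    (hrec : ∀ n, q (n + 2) = (Polynomial.X - C (a (n + 1))) * q (n + 1) - C (b (n + 1)) * q n) (hα : -1 < α) (hβ : -1 < β) (ha0 : a 0 = (β - α) / (α + β + 2))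
    (ha : ∀ n : ℕ, a (n + 1) = (β ^ 2 - α ^ 2) / ((2 * n + 2 + (α + β)) * (2 * n + 4 + (α + β))))
    (hb1 : b 1 = 4 * (1 + α) * (1 + β) / ((α + β + 2) ^ 2 * (α + β + 3)))
    (hb : ∀ n : ℕ, b (n + 2) = 4 * ((n : ℝ) + 2) * ((n : ℝ) + 2 + α) * ((n : ℝ) + 2 + β) * ((n : ℝ) + 2 + (α + β)) /
      ((2 * n + 3 + (α + β)) * (2 * n + 4 + (α + β)) ^ 2 * (2 * n + 5 + (α + β))))
    {t : ℕ} {x : Fin (t + 1) → ℝ} (hxq : q (t + 1) = ∏ k, (Polynomial.X - C (x k))) :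
    ∑ k, x k = ((t : ℝ) + 1) * (β - α) / (2 * (t : ℝ) + 2 + (α + β)) := by
  obtain ⟨⟨hd1, -, -, -⟩, hI, -, -⟩ := jacobi_scalar_identities hα hβ ha0 ha hb1 hb (d := fun m => (m : ℝ) * (β - α) / (2 * (m : ℝ) + (α + β)))
    (e := fun m => (2 * (m : ℝ) + 1 + (α + β)) * b m) (fun _ => rfl) (fun _ => rfl)
  rw [sum_recurrence_zeros hq0 hq1 hrec hxq]
  -- `Σ_{i ≤ t} a_i = d_{t+1}` by telescoping
  have htel : ∀ s : ℕ, ∑ i ∈ Finset.range (s + 1), a i = ((s + 1 : ℕ) : ℝ) * (β - α) / (2 * ((s + 1 : ℕ) : ℝ) + (α + β)) := by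
    intro s
    induction s with
    | zero => rw [Finset.sum_range_one, ← hd1]
    | succ s ih =>
      rw [Finset.sum_range_succ, ih]
      rw [show s + 1 + 1 = s + 2 from rfl, hI s]
  rw [htel t]; push_cast; ring_nf

/-- `Res_{(n+1,2)}(q_{n+1}, X² − 1) = q_{n+1}(1) · q_{n+1}(−1)` for the Jacobi recurrence (instance of N409 `resultant_X_sq_sub_one`). [this file, §1178] -/
theorem jacobi_resultant_X_sq_sub_one {q : ℕ → ℝ[X]} {a b : ℕ → ℝ} (hq0 : q 0 = 1) (hq1 : q 1 = Polynomial.X - C (a 0))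
    (hrec : ∀ n, q (n + 2) = (Polynomial.X - C (a (n + 1))) * q (n + 1) - C (b (n + 1)) * q n) (n : ℕ) :
    (q (n + 1)).resultant (Polynomial.X ^ 2 - 1) (n + 1) 2 = (q (n + 1)).eval 1 * (q (n + 1)).eval (-1) :=
  resultant_X_sq_sub_one (recurrence_natDegree_le_coeff hq0 hq1 hrec (n + 1)).1

/-- **HILBERT'S JACOBI DISCRIMINANT, PRODUCT FORM: `q_{n+1}(1) · ((−1)^{n+1} q_{n+1}(−1)) · disc(q_{n+1}) = ((2n+α+β+3) b_{n+1})^{n+1} ∏_{k<n} b_{k+1}^{k+1}`.** [Hilbert 1888; Stieltjes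
1885; Schur 1931 §2; Szegő (6.71.5); this file, §1178] -/
theorem jacobi_discr_mul {q : ℕ → ℝ[X]} {a b : ℕ → ℝ} {α β : ℝ} (hq0 : q 0 = 1) (hq1 : q 1 = Polynomial.X - C (a 0))
    (hrec : ∀ n, q (n + 2) = (Polynomial.X - C (a (n + 1))) * q (n + 1) - C (b (n + 1)) * q n) (hα : -1 < α) (hβ : -1 < β) (ha0 : a 0 = (β - α) / (α + β + 2))
    (ha : ∀ n : ℕ, a (n + 1) = (β ^ 2 - α ^ 2) / ((2 * n + 2 + (α + β)) * (2 * n + 4 + (α + β))))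
    (hb1 : b 1 = 4 * (1 + α) * (1 + β) / ((α + β + 2) ^ 2 * (α + β + 3)))
    (hb : ∀ n : ℕ, b (n + 2) = 4 * ((n : ℝ) + 2) * ((n : ℝ) + 2 + α) * ((n : ℝ) + 2 + β) * ((n : ℝ) + 2 + (α + β)) /
      ((2 * n + 3 + (α + β)) * (2 * n + 4 + (α + β)) ^ 2 * (2 * n + 5 + (α + β)))) (n : ℕ) :
    (q (n + 1)).eval 1 * ((-1) ^ (n + 1) * (q (n + 1)).eval (-1)) * (q (n + 1)).discr =
      ((2 * ((n : ℝ) + 1) + 1 + (α + β)) * b (n + 1)) ^ (n + 1) * ∏ k ∈ Finset.range n, b (k + 1) ^ (k + 1) := by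
  have hlow : (Polynomial.X ^ 2 - 1) * derivative (q (n + 1)) =
      (C ((n : ℝ) + 1) * Polynomial.X + C (((n : ℝ) + 1) * (β - α) / (2 * ((n : ℝ) + 1) + (α + β)))) * q (n + 1) + C (-((2 * ((n : ℝ) + 1) + 1 + (α + β)) * b (n + 1))) * q n := by
    rw [jacobi_structure_relation hq0 hq1 hrec hα hβ ha0 ha hb1 hb n, map_neg]; ring
  have hπ : (Polynomial.X ^ 2 - 1 : ℝ[X]).natDegree ≤ 2 :=
    (natDegree_sub_le _ _).trans (max_le (natDegree_pow_le_of_le 2 natDegree_X_le) (by rw [natDegree_one]; omega))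
  have hA : (C ((n : ℝ) + 1) * Polynomial.X + C (((n : ℝ) + 1) * (β - α) / (2 * ((n : ℝ) + 1) + (α + β)))).natDegree + 1 ≤ 2 := by
    have h1 := (natDegree_C_mul_le ((n : ℝ) + 1) Polynomial.X).trans natDegree_X_le
    have h2 := natDegree_add_le (C ((n : ℝ) + 1) * Polynomial.X) (C (((n : ℝ) + 1) * (β - α) / (2 * ((n : ℝ) + 1) + (α + β))))
    rw [natDegree_C (((n : ℝ) + 1) * (β - α) / (2 * ((n : ℝ) + 1) + (α + β)))] at h2
    omega
  have h := resultant_mul_discr_recurrence hq0 hq1 hrec hπ hA hlow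
  rw [jacobi_resultant_X_sq_sub_one hq0 hq1 hrec n, neg_pow ((2 * ((n : ℝ) + 1) + 1 + (α + β)) * b (n + 1)) (n + 1)] at h
  have hsq : ((-1 : ℝ) ^ (n + 1)) * ((-1 : ℝ) ^ (n + 1)) = 1 := by rw [← pow_add, ← two_mul, pow_mul, neg_one_sq, one_pow]
  linear_combination ((-1 : ℝ) ^ (n + 1)) * h +
    (((2 * ((n : ℝ) + 1) + 1 + (α + β)) * b (n + 1)) ^ (n + 1) * ∏ k ∈ Finset.range n, b (k + 1) ^ (k + 1)) * hsq

/-- **HILBERT'S JACOBI DISCRIMINANT with the two products inserted:**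
`disc(q_{n+1}) = ((2n+σ+3) b_{n+1})^{n+1} ∏ b_{k+1}^{k+1} ∕ (F_α(n) F_β(n))`, `F_γ(n) = (2(γ+1)∕(σ+2)) ∏_{k<n} 2(k+2+γ)(k+2+σ)∕((2k+3+σ)(2k+4+σ))`. [Szegő (6.71.5); this file, §1178] -/
theorem jacobi_discr {q : ℕ → ℝ[X]} {a b : ℕ → ℝ} {α β : ℝ} (hq0 : q 0 = 1) (hq1 : q 1 = Polynomial.X - C (a 0))
    (hrec : ∀ n, q (n + 2) = (Polynomial.X - C (a (n + 1))) * q (n + 1) - C (b (n + 1)) * q n) (hα : -1 < α) (hβ : -1 < β) (ha0 : a 0 = (β - α) / (α + β + 2))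
    (ha : ∀ n : ℕ, a (n + 1) = (β ^ 2 - α ^ 2) / ((2 * n + 2 + (α + β)) * (2 * n + 4 + (α + β))))
    (hb1 : b 1 = 4 * (1 + α) * (1 + β) / ((α + β + 2) ^ 2 * (α + β + 3)))
    (hb : ∀ n : ℕ, b (n + 2) = 4 * ((n : ℝ) + 2) * ((n : ℝ) + 2 + α) * ((n : ℝ) + 2 + β) * ((n : ℝ) + 2 + (α + β)) /
      ((2 * n + 3 + (α + β)) * (2 * n + 4 + (α + β)) ^ 2 * (2 * n + 5 + (α + β)))) (n : ℕ) :
    (q (n + 1)).discr = ((2 * ((n : ℝ) + 1) + 1 + (α + β)) * b (n + 1)) ^ (n + 1) * (∏ k ∈ Finset.range n, b (k + 1) ^ (k + 1)) /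
      ((2 * (α + 1) / (α + β + 2) * ∏ k ∈ Finset.range n, 2 * ((k : ℝ) + 2 + α) * ((k : ℝ) + 2 + (α + β)) / ((2 * (k : ℝ) + 3 + (α + β)) * (2 * (k : ℝ) + 4 + (α + β)))) *
        (2 * (β + 1) / (α + β + 2) * ∏ k ∈ Finset.range n, 2 * ((k : ℝ) + 2 + β) * ((k : ℝ) + 2 + (α + β)) / ((2 * (k : ℝ) + 3 + (α + β)) * (2 * (k : ℝ) + 4 + (α + β))))) := by
  have h := jacobi_discr_mul hq0 hq1 hrec hα hβ ha0 ha hb1 hb n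
  rw [jacobi_eval_one hq0 hq1 hrec hα hβ ha0 ha hb1 hb n, jacobi_eval_neg_one hq0 hq1 hrec hα hβ ha0 ha hb1 hb n, ← mul_assoc ((-1 : ℝ) ^ (n + 1)), ← pow_add, ← two_mul,
    pow_mul, neg_one_sq, one_pow, one_mul] at h
  have h2 : α + β + 2 ≠ 0 := by linarith
  have hn : ∀ (m : ℕ) (k : ℝ), 2 ≤ k → 0 < 2 * (m : ℝ) + k + (α + β) := fun m k hk => by
    have h0 : (0 : ℝ) ≤ m := Nat.cast_nonneg m
    linarith
  have hFα : 0 < 2 * (α + 1) / (α + β + 2) * ∏ k ∈ Finset.range n, 2 * ((k : ℝ) + 2 + α) * ((k : ℝ) + 2 + (α + β)) / ((2 * (k : ℝ) + 3 + (α + β)) * (2 * (k : ℝ) + 4 + (α + β))) :=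
    mul_pos (div_pos (by linarith) (by linarith)) (Finset.prod_pos fun k _ => by
      have h0 : (0 : ℝ) ≤ k := Nat.cast_nonneg k
      exact div_pos (mul_pos (mul_pos two_pos (by linarith)) (by linarith)) (mul_pos (hn k 3 (by norm_num)) (hn k 4 (by norm_num))))
  have hFβ : 0 < 2 * (β + 1) / (α + β + 2) * ∏ k ∈ Finset.range n, 2 * ((k : ℝ) + 2 + β) * ((k : ℝ) + 2 + (α + β)) / ((2 * (k : ℝ) + 3 + (α + β)) * (2 * (k : ℝ) + 4 + (α + β))) :=
    mul_pos (div_pos (by linarith) (by linarith)) (Finset.prod_pos fun k _ => by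
      have h0 : (0 : ℝ) ≤ k := Nat.cast_nonneg k
      exact div_pos (mul_pos (mul_pos two_pos (by linarith)) (by linarith)) (mul_pos (hn k 3 (by norm_num)) (hn k 4 (by norm_num))))
  rw [eq_div_iff (mul_pos hFα hFβ).ne']
  linear_combination h

end Summit.Ventures.HSemireg.Wedge.HankelOuter
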